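import Mathlib
import HarnessLib
import Literature.NumberTheory.LFunctions.ZetaScrew
import Literature.NumberTheory.LFunctions.ZetaScrewThm41Proofs
import Summits.RiemannHypothesis.RiemannHypothesis.Theorems.IntegerScrewHingeCarrier
import Summits.RiemannHypothesis.RiemannHypothesis.Theorems.IntegerScrewHingeCovariance
import Summits.RiemannHypothesis.RiemannHypothesis.Theorems.IntegerScrewFarDecorrelation

/-!
# Route `IntegerScrew` — the hinge mass sits on ONE increment: the neighbours `I_{⌈M/n⌉±1}` of the carrier
# are uncorrelated with `I_M` at order `1/M` (PIVOT-LAW §15.12 «never split», sharp form; RH-FREE)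

`IntegerScrewHingeCovariance.tendsto_hingeCov`: along `M = n r + j` (`1 ≤ j ≤ n`) the carrier `I_{r+1} = I_{⌈M/n⌉}`
has `M·Cov(I_M, I_{r+1}) → −Λ(n)/√n`.  Complement: the adjacent increments `I_{r+2}`, `I_r` carry NOTHING at this
order, because their four lags lie on ONE side of the kink `log n`, where the prime sum `φ` is affine:

* `tendsto_mul_bracket_zero_of_gap` — the general one-gap decorrelation lemma (`a_M/M → α`, `b_M/M → β`,
  `0 < β < α`, the four lags eventually in one closed gap `[log N, log(N+1)]` ⇒ `M·⟨I_{a_M}, I_{b_M}⟩ → 0`);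
* **`tendsto_aboveCarrier_zero`**, **`tendsto_belowCarrier_zero`** — the two neighbours of the carrier;
* **`tendsto_lagCarrier_of_lt`** / **`tendsto_lagCarrier_of_le`** — along `M ≡ j (mod n)` the carrier
  `I_{⌈M/n⌉}` resonates (`−Λ(n)/√n`) with exactly the `j` increments `I_{M−k}`, `k < j`, and with none of
  `k ≥ j` (PIVOT-LAW §15.14 (i), the residue-dependent cross terms of the arithmetic floor, now exact).

With `tendsto_hingeCov`: of `I_r, I_{r+1}, I_{r+2}` exactly the middle one resonates.  Elementary; nothing here
bears on the truth of RH. [Suzuki2023, (1.1)]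
-/

noncomputable section

-- D-0017: `Summit.<S>.<S>.…` is the designed namespace of a single-problem summit.
set_option linter.dupNamespace false

namespace Summit.RiemannHypothesis.RiemannHypothesis.Theorems.IntegerScrew

open Literature.NumberTheory.LFunctions Literature.NumberTheory.LFunctions.Suzuki2023Thm41
open Filter Set Finset
open scoped Topology

/-- Eventually (in `M : ℕ`) the real cast exceeds any given real. [folklore] -/
private theorem eventually_natCast_gt₄ (c : ℝ) : ∀ᶠ M : ℕ in atTop, c < (M : ℝ) :=
  tendsto_natCast_atTop_atTop.eventually (eventually_gt_atTop c)

/-- **DECORRELATION ACROSS ONE GAP.**  Let `a, b : ℕ → ℕ` with `a_M/M → α`, `b_M/M → β`, `0 < β < α`,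
and suppose that eventually the four lags `log(a/(b−1))`, `log((a−1)/b)`, `log(a/b)`, `log((a−1)/(b−1))` all
lie in ONE closed gap `[log N, log(N+1)]` (`N ≥ 1`) of the prime sum.  Then
`M·[Ψ(log(a/(b−1))) + Ψ(log((a−1)/b)) − Ψ(log(a/b)) − Ψ(log((a−1)/(b−1)))] → 0`: on the gap `φ` is affine
(mixed difference `0`), and `Ψ_wall` is `C¹` (mixed difference `o(1/M)`).  Covers the non-integer ratios
(`IntegerScrewFarDecorrelation`) and the one-sided integer-ratio configurations next to a hinge carrier
(below). [folklore] -/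
theorem tendsto_mul_bracket_zero_of_gap (a b : ℕ → ℕ) {α β : ℝ} (hβ : 0 < β) (hαβ : β < α)
    (ha : Tendsto (fun M : ℕ => (a M : ℝ) / M) atTop (𝓝 α))
    (hb : Tendsto (fun M : ℕ => (b M : ℝ) / M) atTop (𝓝 β)) {N : ℕ} (hN1 : 1 ≤ N)
    (hgap : ∀ᶠ M : ℕ in atTop,
      Real.log ((a M : ℝ) / ((b M : ℝ) - 1)) ∈ Icc (Real.log N) (Real.log ((N : ℝ) + 1))
      ∧ Real.log (((a M : ℝ) - 1) / (b M : ℝ)) ∈ Icc (Real.log N) (Real.log ((N : ℝ) + 1))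
      ∧ Real.log ((a M : ℝ) / (b M : ℝ)) ∈ Icc (Real.log N) (Real.log ((N : ℝ) + 1))
      ∧ Real.log (((a M : ℝ) - 1) / ((b M : ℝ) - 1)) ∈ Icc (Real.log N) (Real.log ((N : ℝ) + 1))) :
    Tendsto (fun M : ℕ => (M : ℝ) * (zetaScrew (Real.log ((a M : ℝ) / ((b M : ℝ) - 1)))
        + zetaScrew (Real.log (((a M : ℝ) - 1) / (b M : ℝ)))
        - zetaScrew (Real.log ((a M : ℝ) / (b M : ℝ)))
        - zetaScrew (Real.log (((a M : ℝ) - 1) / ((b M : ℝ) - 1))))) atTop (𝓝 0) := by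
  have hα : 0 < α := hβ.trans hαβ
  set ℓ : ℝ := Real.log (α / β) with hℓ
  have hρ1 : 1 < α / β := by rw [lt_div_iff₀ hβ, one_mul]; exact hαβ
  have hℓ0 : 0 < ℓ := Real.log_pos hρ1
  have hN0 : (0 : ℝ) < N := by exact_mod_cast hN1
  -- asymptotics of a, b (as in `IntegerScrewFarBrackets`)
  have hinv : Tendsto (fun M : ℕ => (1 : ℝ) / M) atTop (𝓝 0) :=
    tendsto_const_nhds.div_atTop tendsto_natCast_atTop_atTop
  have ha' : Tendsto (fun M : ℕ => ((a M : ℝ) - 1) / M) atTop (𝓝 α) := by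
    have := ha.sub hinv
    rw [sub_zero] at this
    exact this.congr fun M => by ring
  have hb' : Tendsto (fun M : ℕ => ((b M : ℝ) - 1) / M) atTop (𝓝 β) := by
    have := hb.sub hinv
    rw [sub_zero] at this
    exact this.congr fun M => by ring
  have haT : Tendsto (fun M : ℕ => (a M : ℝ)) atTop atTop := by
    refine (ha.pos_mul_atTop hα tendsto_natCast_atTop_atTop).congr' ?_
    filter_upwards [eventually_natCast_gt₄ 0] with M hM
    field_simp
  have hbT : Tendsto (fun M : ℕ => (b M : ℝ)) atTop atTop := by
    refine (hb.pos_mul_atTop hβ tendsto_natCast_atTop_atTop).congr' ?_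
    filter_upwards [eventually_natCast_gt₄ 0] with M hM
    field_simp
  have ha2 : ∀ᶠ M : ℕ in atTop, (2 : ℝ) ≤ a M := haT.eventually (eventually_ge_atTop 2)
  have hb2 : ∀ᶠ M : ℕ in atTop, (2 : ℝ) ≤ b M := hbT.eventually (eventually_ge_atTop 2)
  have hb0 : ∀ᶠ M : ℕ in atTop, (0 : ℝ) < b M := by filter_upwards [hb2] with M hM; linarith
  have hb10 : ∀ᶠ M : ℕ in atTop, (0 : ℝ) < (b M : ℝ) - 1 := by filter_upwards [hb2] with M hM; linarith
  have hlag : ∀ (u v : ℕ → ℝ), Tendsto (fun M : ℕ => u M / M) atTop (𝓝 α) →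
      Tendsto (fun M : ℕ => v M / M) atTop (𝓝 β) → (∀ᶠ M : ℕ in atTop, 0 < v M) →
      Tendsto (fun M : ℕ => Real.log (u M / v M)) atTop (𝓝 ℓ) := by
    intro u v hu hv hv0
    have hq : Tendsto (fun M : ℕ => (u M / M) / (v M / M)) atTop (𝓝 (α / β)) := hu.div hv hβ.ne'
    have hq' : Tendsto (fun M : ℕ => u M / v M) atTop (𝓝 (α / β)) := by
      refine hq.congr' ?_
      filter_upwards [eventually_natCast_gt₄ 0, hv0] with M hM hvM
      field_simp
    exact (Real.continuousAt_log (by positivity : α / β ≠ 0)).tendsto.comp hq'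
  -- the lags P₃ = log(a/b) → ℓ, and the cell sides h_a = log(a/(a−1)) → 0, h_b = log(b/(b−1)) → 0
  have hP3 := hlag (fun M => (a M : ℝ)) (fun M => (b M : ℝ)) ha hb hb0
  have hside : ∀ (u : ℕ → ℝ), Tendsto u atTop atTop →
      Tendsto (fun M : ℕ => Real.log (u M / (u M - 1))) atTop (𝓝 0) := by
    intro u hu
    have h1 : Tendsto (fun M => u M / (u M - 1)) atTop (𝓝 1) := by
      have hi : Tendsto (fun M => (u M)⁻¹) atTop (𝓝 0) := hu.inv_tendsto_atTop
      have h2 : Tendsto (fun M => (1 : ℝ) / (1 - (u M)⁻¹)) atTop (𝓝 (1 / (1 - 0))) :=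
        tendsto_const_nhds.div (tendsto_const_nhds.sub hi) (by norm_num)
      rw [sub_zero, div_one] at h2
      refine h2.congr' ?_
      filter_upwards [hu.eventually (eventually_gt_atTop 1)] with M hM
      have : u M ≠ 0 := by linarith
      field_simp
    have := (Real.continuousAt_log one_ne_zero).tendsto.comp h1
    simpa only [Function.comp_def, Real.log_one] using this
  have hha := hside (fun M => (a M : ℝ)) haT
  have hhb := hside (fun M => (b M : ℝ)) hbT
  -- M·h_b is eventually ≤ 2/β
  have hMb : Tendsto (fun M : ℕ => (M : ℝ) / ((b M : ℝ) - 1)) atTop (𝓝 (1 / β)) := by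
    have h := hb'.inv₀ hβ.ne'
    refine (h.congr' ?_).trans (by rw [one_div])
    filter_upwards [eventually_natCast_gt₄ 0] with M hM
    rw [inv_div]
  have hMb2 : ∀ᶠ M : ℕ in atTop, (M : ℝ) / ((b M : ℝ) - 1) ≤ 2 / β :=
    hMb.eventually (Iic_mem_nhds (by rw [one_div, lt_div_iff₀ hβ, inv_mul_cancel₀ hβ.ne']; norm_num))
  -- ε–argument
  rw [Metric.tendsto_atTop]
  intro η hη
  obtain ⟨δ, hδ0, hδ⟩ := wallPsi_mixed_le hℓ0 (show 0 < η * β / 4 by positivity)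
  have hsmall : Icc (ℓ - δ) (ℓ + δ) ∈ 𝓝 ℓ := Icc_mem_nhds (by linarith) (by linarith)
  have hsmall0 : Icc (-δ) δ ∈ 𝓝 (0 : ℝ) := Icc_mem_nhds (by linarith) (by linarith)
  have hev : ∀ᶠ M : ℕ in atTop,
      Real.log ((a M : ℝ) / (b M : ℝ)) ∈ Icc (ℓ - δ) (ℓ + δ)
      ∧ Real.log ((a M : ℝ) / ((a M : ℝ) - 1)) ∈ Icc (-δ) δ
      ∧ Real.log ((b M : ℝ) / ((b M : ℝ) - 1)) ∈ Icc (-δ) δ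
      ∧ Real.log ((a M : ℝ) / ((b M : ℝ) - 1)) ∈ Icc (Real.log N) (Real.log ((N : ℝ) + 1))
      ∧ Real.log (((a M : ℝ) - 1) / (b M : ℝ)) ∈ Icc (Real.log N) (Real.log ((N : ℝ) + 1))
      ∧ Real.log ((a M : ℝ) / (b M : ℝ)) ∈ Icc (Real.log N) (Real.log ((N : ℝ) + 1))
      ∧ Real.log (((a M : ℝ) - 1) / ((b M : ℝ) - 1)) ∈ Icc (Real.log N) (Real.log ((N : ℝ) + 1))
      ∧ (2 : ℝ) ≤ a M ∧ (2 : ℝ) ≤ b M ∧ (M : ℝ) / ((b M : ℝ) - 1) ≤ 2 / β ∧ (0 : ℝ) < M := by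
    filter_upwards [hP3.eventually hsmall, hha.eventually hsmall0, hhb.eventually hsmall0,
      hgap, ha2, hb2, hMb2, eventually_natCast_gt₄ 0] with M h1 h2 h3 h4 h8 h9 h10 h11
    exact ⟨h1, h2, h3, h4.1, h4.2.1, h4.2.2.1, h4.2.2.2, h8, h9, h10, h11⟩
  obtain ⟨M₀, hM₀⟩ := eventually_atTop.1 hev
  refine ⟨M₀, fun M hM => ?_⟩
  obtain ⟨h3, hha', hhb', g1, g2, g3, g4, haM, hbM, hMbM, hM0⟩ := hM₀ M hM
  have ha0 : (0 : ℝ) < a M := by linarith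
  have ha1 : (0 : ℝ) < (a M : ℝ) - 1 := by linarith
  have hb0' : (0 : ℝ) < b M := by linarith
  have hb1 : (0 : ℝ) < (b M : ℝ) - 1 := by linarith
  -- names for the lags and the sides
  set x : ℝ := Real.log ((a M : ℝ) / (b M : ℝ)) with hx
  set sa : ℝ := Real.log ((a M : ℝ) / ((a M : ℝ) - 1)) with hsa
  set sb : ℝ := Real.log ((b M : ℝ) / ((b M : ℝ) - 1)) with hsb
  have e1 : Real.log ((a M : ℝ) / ((b M : ℝ) - 1)) = x + sb := by
    simp only [hx, hsb]
    rw [Real.log_div ha0.ne' hb1.ne', Real.log_div ha0.ne' hb0'.ne', Real.log_div hb0'.ne' hb1.ne']; ring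
  have e2 : Real.log (((a M : ℝ) - 1) / (b M : ℝ)) = x - sa := by
    simp only [hx, hsa]
    rw [Real.log_div ha1.ne' hb0'.ne', Real.log_div ha0.ne' hb0'.ne', Real.log_div ha0.ne' ha1.ne']; ring
  have e4 : Real.log (((a M : ℝ) - 1) / ((b M : ℝ) - 1)) = x + sb - sa := by
    simp only [hx, hsa, hsb]
    rw [Real.log_div ha1.ne' hb1.ne', Real.log_div ha0.ne' hb0'.ne', Real.log_div ha0.ne' ha1.ne',
      Real.log_div hb0'.ne' hb1.ne']; ring
  have hsa0 : 0 ≤ sa := Real.log_nonneg (by rw [le_div_iff₀ ha1]; linarith)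
  have hsb0 : 0 ≤ sb := Real.log_nonneg (by rw [le_div_iff₀ hb1]; linarith)
  -- all four lags are ≥ 0 (they exceed log N ≥ 0)
  have hlogN0 : 0 ≤ Real.log (N : ℝ) := Real.log_nonneg (by exact_mod_cast hN1)
  have hpos : ∀ {P : ℝ}, P ∈ Icc (Real.log N) (Real.log ((N : ℝ) + 1)) → 0 ≤ P :=
    fun hP => hlogN0.trans hP.1
  -- Ψ = Ψ_wall − φ at the four lags; the φ part vanishes
  have hφ : zetaScrewPrimeSum (x + sb) + zetaScrewPrimeSum (x - sa) - zetaScrewPrimeSum x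
      - zetaScrewPrimeSum (x + sb - sa) = 0 := by
    rw [← e4, ← e1, ← e2]
    exact primeSum_fourPoint_eq_zero_of_gap hN1 g1 g2 g3 g4 (by rw [e1, e2, e4]; ring)
  have hwall : |wallPsi (x + sb) + wallPsi (x - sa) - wallPsi x - wallPsi (x + sb - sa)| ≤ η * β / 4 * sb := by
    refine hδ x sb sa ?_ hsb0 ?_ hsa0 ?_
    · have := h3; rw [Set.mem_Icc] at this; rw [abs_le]; constructor <;> linarith
    · exact (Set.mem_Icc.1 hhb').2
    · exact (Set.mem_Icc.1 hha').2
  have hB : zetaScrew (Real.log ((a M : ℝ) / ((b M : ℝ) - 1)))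
        + zetaScrew (Real.log (((a M : ℝ) - 1) / (b M : ℝ)))
        - zetaScrew (Real.log ((a M : ℝ) / (b M : ℝ)))
        - zetaScrew (Real.log (((a M : ℝ) - 1) / ((b M : ℝ) - 1)))
      = wallPsi (x + sb) + wallPsi (x - sa) - wallPsi x - wallPsi (x + sb - sa) := by
    rw [e1, e2, e4, ← hx, zetaScrew_eq_wallPsi_sub_primeSum (by rw [← e1]; exact hpos g1),
      zetaScrew_eq_wallPsi_sub_primeSum (by rw [← e2]; exact hpos g2),
      zetaScrew_eq_wallPsi_sub_primeSum (hpos g3),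
      zetaScrew_eq_wallPsi_sub_primeSum (by rw [← e4]; exact hpos g4)]
    linarith [hφ]
  rw [Real.dist_eq, sub_zero, hB, abs_mul, abs_of_pos hM0]
  -- M·(ηβ/4)·sb ≤ (ηβ/4)·(M/(b−1)) ≤ (ηβ/4)(2/β) = η/2 < η
  have hsb1 : sb ≤ 1 / ((b M : ℝ) - 1) := by
    have := Real.log_le_sub_one_of_pos (show 0 < (b M : ℝ) / ((b M : ℝ) - 1) by positivity)
    have e : (b M : ℝ) / ((b M : ℝ) - 1) - 1 = 1 / ((b M : ℝ) - 1) := by field_simp; ring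
    simp only [hsb]; linarith [e]
  calc (M : ℝ) * |wallPsi (x + sb) + wallPsi (x - sa) - wallPsi x - wallPsi (x + sb - sa)|
      ≤ (M : ℝ) * (η * β / 4 * sb) := mul_le_mul_of_nonneg_left hwall hM0.le
    _ ≤ (M : ℝ) * (η * β / 4 * (1 / ((b M : ℝ) - 1))) := by gcongr
    _ = η * β / 4 * ((M : ℝ) / ((b M : ℝ) - 1)) := by ring
    _ ≤ η * β / 4 * (2 / β) := by gcongr
    _ = η / 2 := by field_simp; ring
    _ < η := by linarith


/-! ### The two neighbours of the carrier -/
/-- `r ↦ n·r + j` tends to infinity for `n ≥ 1`. [folklore] -/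
private theorem tendsto_const_mul_add_nat₃ {n : ℕ} (hn : 1 ≤ n) (j : ℕ) :
    Tendsto (fun r : ℕ => n * r + j) atTop atTop :=
  Filter.tendsto_atTop_mono (fun r => (Nat.le_mul_of_pos_left r (by omega)).trans
    (Nat.le_add_right _ _)) tendsto_id

/-- `(n r + j)/r → n`. [folklore] -/
private theorem tendsto_corner_div {n : ℕ} (j : ℕ) :
    Tendsto (fun r : ℕ => (((n * r + j : ℕ)) : ℝ) / r) atTop (𝓝 (n : ℝ)) := by
  have h : Tendsto (fun r : ℕ => (n : ℝ) + (j : ℝ) / r) atTop (𝓝 ((n : ℝ) + 0)) :=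
    tendsto_const_nhds.add (tendsto_const_nhds.div_atTop tendsto_natCast_atTop_atTop)
  rw [add_zero] at h
  refine h.congr' ?_
  filter_upwards [eventually_ge_atTop 1] with r hr
  have hr0 : (0 : ℝ) < r := by exact_mod_cast (by omega : 0 < r)
  push_cast
  field_simp

/-- `(r + i)/r → 1`. [folklore] -/
private theorem tendsto_shift_div (i : ℕ) :
    Tendsto (fun r : ℕ => (((r + i : ℕ)) : ℝ) / r) atTop (𝓝 1) := by
  simpa only [one_mul, Nat.cast_one] using tendsto_corner_div (n := 1) i

/-- **ABOVE THE CARRIER NOTHING RESONATES.**  For `n ≥ 2`, `1 ≤ j ≤ n`, along `M = n r + j` (carrier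
`I_{r+1}`): `M·[Ψ(log(M/(r+1))) + Ψ(log((M−1)/(r+2))) − Ψ(log(M/(r+2))) − Ψ(log((M−1)/(r+1)))] → 0`, i.e.
`M·Cov(I_M, I_{r+2}) → 0` (the four lags lie in `[log(n−1), log n]`). [folklore] -/
theorem tendsto_aboveCarrier_zero {n j : ℕ} (hn : 2 ≤ n) (hj1 : 1 ≤ j) (hjn : j ≤ n) :
    Tendsto (fun r : ℕ => ((n * r + j : ℕ) : ℝ) *
        (zetaScrew (Real.log (((n * r + j : ℕ) : ℝ) / (((r + 2 : ℕ) : ℝ) - 1)))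
          + zetaScrew (Real.log ((((n * r + j : ℕ) : ℝ) - 1) / ((r + 2 : ℕ) : ℝ)))
          - zetaScrew (Real.log (((n * r + j : ℕ) : ℝ) / ((r + 2 : ℕ) : ℝ)))
          - zetaScrew (Real.log ((((n * r + j : ℕ) : ℝ) - 1) / (((r + 2 : ℕ) : ℝ) - 1)))))
      atTop (𝓝 0) := by
  have hn1 : 1 ≤ n - 1 := by omega
  have hcastN : ((n - 1 : ℕ) : ℝ) = (n : ℝ) - 1 := by rw [Nat.cast_sub (by omega), Nat.cast_one]
  have hn' : (2 : ℝ) ≤ n := by exact_mod_cast hn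
  have hj' : (1 : ℝ) ≤ j := by exact_mod_cast hj1
  have hjn' : (j : ℝ) ≤ n := by exact_mod_cast hjn
  -- the index is r; scale r: a_r/r → n, b_r/r → 1
  have h := tendsto_mul_bracket_zero_of_gap (fun r => n * r + j) (fun r => r + 2) (α := (n : ℝ)) (β := 1)
    one_pos (by linarith) (tendsto_corner_div j) (tendsto_shift_div 2) hn1 ?_
  · -- the prefactor in `h` is `r`, ours is `M = n r + j`: multiply by M/r → n (bounded) … simpler: h gives
    -- r·B → 0; M·B = (M/r)·(r·B) → n·0
    have h2 := (tendsto_corner_div (n := n) j).mul h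
    rw [mul_zero] at h2
    refine h2.congr' ?_
    filter_upwards [eventually_ge_atTop 1] with r hr
    have hr0 : (0 : ℝ) < r := by exact_mod_cast (by omega : 0 < r)
    field_simp
  · -- gap membership: all four lags in [log(n−1), log n] for r ≥ 2n + 2
    filter_upwards [eventually_ge_atTop (2 * n + 2)] with r hr
    have hr' : (2 : ℝ) * n + 2 ≤ r := by exact_mod_cast hr
    have hr0 : (0 : ℝ) < r := by linarith
    have hM : (((n * r + j : ℕ)) : ℝ) = (n : ℝ) * r + j := by push_cast; ring
    have hb : (((r + 2 : ℕ)) : ℝ) = (r : ℝ) + 2 := by push_cast; ring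
    rw [hM, hb, hcastN]
    have hlo : ∀ {x y : ℝ}, 0 < y → ((n : ℝ) - 1) * y ≤ x → Real.log ((n : ℝ) - 1) ≤ Real.log (x / y) :=
      fun hy hxy => Real.log_le_log (by linarith) (by rw [le_div_iff₀ hy]; exact hxy)
    have hhi : ∀ {x y : ℝ}, 0 < y → 0 < x → x ≤ (n : ℝ) * y → Real.log (x / y) ≤ Real.log ((n : ℝ) - 1 + 1) :=
      fun hy hx hxy => by rw [sub_add_cancel]; exact Real.log_le_log (by positivity) (by rw [div_le_iff₀ hy]; exact hxy)
    refine ⟨⟨hlo (by linarith) (by nlinarith), hhi (by linarith) (by nlinarith) (by nlinarith)⟩,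
      ⟨hlo (by linarith) (by nlinarith), hhi (by linarith) (by nlinarith) (by nlinarith)⟩,
      ⟨hlo (by linarith) (by nlinarith), hhi (by linarith) (by nlinarith) (by nlinarith)⟩,
      ⟨hlo (by linarith) (by nlinarith), hhi (by linarith) (by nlinarith) (by nlinarith)⟩⟩

/-- **BELOW THE CARRIER NOTHING RESONATES.**  For `n ≥ 2`, `1 ≤ j ≤ n`, along `M = n r + j` (carrier
`I_{r+1}`): `M·[Ψ(log(M/(r−1))) + Ψ(log((M−1)/r)) − Ψ(log(M/r)) − Ψ(log((M−1)/(r−1)))] → 0`, i.e.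
`M·Cov(I_M, I_r) → 0` (the four lags lie in `[log n, log(n+1)]`). [folklore] -/
theorem tendsto_belowCarrier_zero {n j : ℕ} (hn : 2 ≤ n) (hj1 : 1 ≤ j) (hjn : j ≤ n) :
    Tendsto (fun r : ℕ => ((n * r + j : ℕ) : ℝ) *
        (zetaScrew (Real.log (((n * r + j : ℕ) : ℝ) / (((r : ℕ) : ℝ) - 1)))
          + zetaScrew (Real.log ((((n * r + j : ℕ) : ℝ) - 1) / ((r : ℕ) : ℝ)))
          - zetaScrew (Real.log (((n * r + j : ℕ) : ℝ) / ((r : ℕ) : ℝ)))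
          - zetaScrew (Real.log ((((n * r + j : ℕ) : ℝ) - 1) / (((r : ℕ) : ℝ) - 1)))))
      atTop (𝓝 0) := by
  have hn' : (2 : ℝ) ≤ n := by exact_mod_cast hn
  have hj' : (1 : ℝ) ≤ j := by exact_mod_cast hj1
  have hjn' : (j : ℝ) ≤ n := by exact_mod_cast hjn
  have h := tendsto_mul_bracket_zero_of_gap (fun r => n * r + j) (fun r => r) (α := (n : ℝ)) (β := 1)
    one_pos (by linarith) (tendsto_corner_div j) ?_ (by omega : 1 ≤ n) ?_
  · have h2 := (tendsto_corner_div (n := n) j).mul h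
    rw [mul_zero] at h2
    refine h2.congr' ?_
    filter_upwards [eventually_ge_atTop 1] with r hr
    have hr0 : (0 : ℝ) < r := by exact_mod_cast (by omega : 0 < r)
    field_simp
  · have := tendsto_shift_div 0
    simpa using this
  · filter_upwards [eventually_ge_atTop (2 * n + 2)] with r hr
    have hr' : (2 : ℝ) * n + 2 ≤ r := by exact_mod_cast hr
    have hr0 : (0 : ℝ) < r := by linarith
    have hM : (((n * r + j : ℕ)) : ℝ) = (n : ℝ) * r + j := by push_cast; ring
    rw [hM]
    have hlo : ∀ {x y : ℝ}, 0 < y → (n : ℝ) * y ≤ x → Real.log (n : ℝ) ≤ Real.log (x / y) :=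
      fun hy hxy => Real.log_le_log (by linarith) (by rw [le_div_iff₀ hy]; exact hxy)
    have hhi : ∀ {x y : ℝ}, 0 < y → 0 < x → x ≤ ((n : ℝ) + 1) * y → Real.log (x / y) ≤ Real.log ((n : ℝ) + 1) :=
      fun hy hx hxy => Real.log_le_log (by positivity) (by rw [div_le_iff₀ hy]; exact hxy)
    refine ⟨⟨hlo (by linarith) (by nlinarith), hhi (by linarith) (by nlinarith) (by nlinarith)⟩,
      ⟨hlo hr0 (by nlinarith), hhi hr0 (by nlinarith) (by nlinarith)⟩,
      ⟨hlo hr0 (by nlinarith), hhi hr0 (by nlinarith) (by nlinarith)⟩,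
      ⟨hlo (by linarith) (by nlinarith), hhi (by linarith) (by nlinarith) (by nlinarith)⟩⟩

/-! ### The lagged corners against the carrier of `M` (PIVOT-LAW §15.14 (i)) -/
/-- **LAG `k < j`: FULL RESONANCE.**  For `n ≥ 2`, `k + 1 ≤ j ≤ n`, along `M = n r + j` (carrier of `M` is
`I_{r+1}`, and it is also the carrier of `M − k = n r + (j − k)`):
`M·⟨I_{M−k}, I_{r+1}⟩ → −Λ(n)/√n`. [folklore] -/
theorem tendsto_lagCarrier_of_lt {n j k : ℕ} (hn : 2 ≤ n) (hkj : k + 1 ≤ j) (hjn : j ≤ n) :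
    Tendsto (fun r : ℕ => ((n * r + j : ℕ) : ℝ) *
        (zetaScrew (Real.log (((n * r + j - k : ℕ) : ℝ) / (((r + 1 : ℕ) : ℝ) - 1)))
          + zetaScrew (Real.log ((((n * r + j - k : ℕ) : ℝ) - 1) / ((r + 1 : ℕ) : ℝ)))
          - zetaScrew (Real.log (((n * r + j - k : ℕ) : ℝ) / ((r + 1 : ℕ) : ℝ)))
          - zetaScrew (Real.log ((((n * r + j - k : ℕ) : ℝ) - 1) / (((r + 1 : ℕ) : ℝ) - 1)))))
      atTop (𝓝 (-(ArithmeticFunction.vonMangoldt n / Real.sqrt n))) := by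
  have h := tendsto_hingeCov (n := n) (j := j - k) hn (by omega) (by omega)
  -- prefactor (n r + j)/(n r + (j − k)) → 1
  have hratio : Tendsto (fun r : ℕ => ((n * r + j : ℕ) : ℝ) / ((n : ℝ) * r + ((j - k : ℕ) : ℝ))) atTop
      (𝓝 1) := by
    have h1 := (tendsto_corner_div (n := n) j).div (tendsto_corner_div (n := n) (j - k))
      (by exact_mod_cast (by omega : n ≠ 0))
    rw [div_self (by exact_mod_cast (by omega : n ≠ 0))] at h1
    refine h1.congr' ?_
    filter_upwards [eventually_ge_atTop 1] with r hr
    have hr0 : (0 : ℝ) < r := by exact_mod_cast (by omega : 0 < r)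
    have hc : (((n * r + (j - k) : ℕ)) : ℝ) = (n : ℝ) * r + ((j - k : ℕ) : ℝ) := by push_cast; ring
    simp only [Pi.div_apply]
    rw [hc]
    field_simp
  have h2 := hratio.mul h
  rw [one_mul] at h2
  refine h2.congr' ?_
  filter_upwards [eventually_ge_atTop 1] with r hr
  have hjk : ((n * r + j - k : ℕ) : ℝ) = (n : ℝ) * r + ((j - k : ℕ) : ℝ) := by
    rw [Nat.cast_sub (by omega), Nat.cast_sub (by omega)]; push_cast; ring
  have hr1 : (((r + 1 : ℕ)) : ℝ) = (r : ℝ) + 1 := by push_cast; ring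
  have hpos : (0 : ℝ) < (n : ℝ) * r + ((j - k : ℕ) : ℝ) := by positivity
  rw [hjk, hr1, add_sub_cancel_right]
  field_simp

/-- **LAG `k ≥ j`: NO RESONANCE.**  For `n ≥ 2`, `j ≤ k`, along `M = n r + j` (for `1 ≤ j ≤ n` the carrier of `M` is
`I_{r+1}`, one ABOVE the carrier of `M − k`): `M·⟨I_{M−k}, I_{r+1}⟩ → 0`. Together with
`tendsto_lagCarrier_of_lt`: when `M ≡ j (mod n)` the carrier `I_{⌈M/n⌉}` resonates with exactly the `j`
increments `I_M, I_{M−1}, …, I_{M−j+1}` (each with `−Λ(n)/√n`) and with none below. [folklore] -/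
theorem tendsto_lagCarrier_of_le {n j k : ℕ} (hn : 2 ≤ n) (hjk : j ≤ k) :
    Tendsto (fun r : ℕ => ((n * r + j : ℕ) : ℝ) *
        (zetaScrew (Real.log (((n * r + j - k : ℕ) : ℝ) / (((r + 1 : ℕ) : ℝ) - 1)))
          + zetaScrew (Real.log ((((n * r + j - k : ℕ) : ℝ) - 1) / ((r + 1 : ℕ) : ℝ)))
          - zetaScrew (Real.log (((n * r + j - k : ℕ) : ℝ) / ((r + 1 : ℕ) : ℝ)))
          - zetaScrew (Real.log ((((n * r + j - k : ℕ) : ℝ) - 1) / (((r + 1 : ℕ) : ℝ) - 1)))))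
      atTop (𝓝 0) := by
  have hn1 : 1 ≤ n - 1 := by omega
  have hcastN : ((n - 1 : ℕ) : ℝ) = (n : ℝ) - 1 := by rw [Nat.cast_sub (by omega), Nat.cast_one]
  have hn' : (2 : ℝ) ≤ n := by exact_mod_cast hn
  have hk' : (j : ℝ) ≤ k := by exact_mod_cast hjk
  -- the lagged corner a_r = n r + j − k over the scale r tends to n; the node b_r = r + 1
  have ha : Tendsto (fun r : ℕ => (((n * r + j - k : ℕ)) : ℝ) / r) atTop (𝓝 (n : ℝ)) := by
    have h1 := (tendsto_corner_div (n := n) j).sub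
      (tendsto_const_nhds.div_atTop tendsto_natCast_atTop_atTop : Tendsto (fun r : ℕ => (k : ℝ) / r) atTop (𝓝 0))
    rw [sub_zero] at h1
    refine h1.congr' ?_
    filter_upwards [eventually_ge_atTop (k + 1)] with r hr
    have hr0 : (0 : ℝ) < r := by exact_mod_cast (by omega : 0 < r)
    have hle : k ≤ n * r + j := by nlinarith
    rw [Nat.cast_sub hle]; push_cast
    field_simp
  have h := tendsto_mul_bracket_zero_of_gap (fun r => n * r + j - k) (fun r => r + 1) (α := (n : ℝ)) (β := 1)
    one_pos (by linarith) ha (tendsto_shift_div 1) hn1 ?_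
  · have h2 := (tendsto_corner_div (n := n) j).mul h
    rw [mul_zero] at h2
    refine h2.congr' ?_
    filter_upwards [eventually_ge_atTop 1] with r hr
    have hr0 : (0 : ℝ) < r := by exact_mod_cast (by omega : 0 < r)
    field_simp
  · filter_upwards [eventually_ge_atTop (2 * n + k + 2)] with r hr
    have hr' : (2 : ℝ) * n + k + 2 ≤ r := by exact_mod_cast hr
    have hr0 : (0 : ℝ) < r := by linarith
    have hle : k ≤ n * r + j := by nlinarith
    have hM : (((n * r + j - k : ℕ)) : ℝ) = (n : ℝ) * r + j - k := by
      rw [Nat.cast_sub hle]; push_cast; ring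
    have hb : (((r + 1 : ℕ)) : ℝ) = (r : ℝ) + 1 := by push_cast; ring
    rw [hM, hb, hcastN, add_sub_cancel_right]
    have hlo : ∀ {x y : ℝ}, 0 < y → ((n : ℝ) - 1) * y ≤ x → Real.log ((n : ℝ) - 1) ≤ Real.log (x / y) :=
      fun hy hxy => Real.log_le_log (by linarith) (by rw [le_div_iff₀ hy]; exact hxy)
    have hhi : ∀ {x y : ℝ}, 0 < y → 0 < x → x ≤ (n : ℝ) * y → Real.log (x / y) ≤ Real.log ((n : ℝ) - 1 + 1) :=
      fun hy hx hxy => by rw [sub_add_cancel]; exact Real.log_le_log (by positivity) (by rw [div_le_iff₀ hy]; exact hxy)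
    refine ⟨⟨hlo hr0 (by nlinarith), hhi hr0 (by nlinarith) (by nlinarith)⟩,
      ⟨hlo (by linarith) (by nlinarith), hhi (by linarith) (by nlinarith) (by nlinarith)⟩,
      ⟨hlo (by linarith) (by nlinarith), hhi (by linarith) (by nlinarith) (by nlinarith)⟩,
      ⟨hlo hr0 (by nlinarith), hhi hr0 (by nlinarith) (by nlinarith)⟩⟩

end Summit.RiemannHypothesis.RiemannHypothesis.Theorems.IntegerScrew

end
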